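import Literature.NumberTheory.Sieve.KloostermanQuintilinearWeightInstances
import Mathlib.Analysis.Calculus.ContDiff.Operations
import HarnessLib

/-!
# The weight `g(𝐜,𝐝,𝐧,𝐫,𝐬)` of Drappeau 2017, §5.5 satisfies the hypotheses of Theorem 2.1

Topic `Literature/NumberTheory/Sieve`.  Before (5.24) of S. Drappeau, Proc. LMS 114 (2017)
(arXiv:1504.05549 p. 20–21) the quintilinear Kloosterman bound (Theorem 2.1 there; corrected form
Assing–Blomer–Li 2021, Theorem 2.3) is applied with the smooth weight
`g(𝐜,𝐝) = γ(q₀𝐝) γ(q₀𝐜) α(ξ q₀𝐜𝐝)` in the smooth variables (the other three variables carrying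
cut-offs `≡ 1` on the support of the coefficients).  Theorem 2.1 wants `g` supported in dyadic
boxes `(C,2C] × (D,2D]`, smooth, compactly supported, with
`∂^ν g ≪_ν (c^{-ν₁}…s^{-ν₅})^{1−ε₀}`; since `γ = BFI.bump S Y` (`Y = Sx^{−δ}`) is supported in
`(S−Y, 2S+Y)` (ratio `< 3`), `γ(q₀·)` is first split smoothly into two dyadically supported pieces.
This file defines these concrete weights and proves all four hypotheses (everything proved; the
definitions are the concrete weight functions, no named fact):

* `gammaDil S Y q₀ = γ(q₀·)`, `splitDil`, `pieceLo`, `pieceHi` (`pieceLo + pieceHi = gammaDil`,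
  supports in `(29S/(40q₀), 29S/(20q₀)]` and `(9S/(8q₀), 9S/(4q₀)]`), `plateau M = BFI.bumpC M (M/2)`,
  `alphaProfile = BFI.bumpC 1 (1/2)`, and `drWeight A B κ Mn R S'` (the five-variable weight);
* `DerivBound` families, vanishing, smoothness and compact support of the pieces;
* `contDiff_drWeight`, `hasCompactSupport_drWeight`, `drWeight_ne_zero`, `norm_mixedDeriv_drWeight_le`
  — the hypotheses of Theorem 2.1 / Theorem 2.3 for `drWeight`.

## References

* S. Drappeau, Proc. London Math. Soc. (3) 114 (2017) 684–732, arXiv:1504.05549, §5.2 (weights),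
  §5.5 p. 20–21, Theorem 2.1 (2.2). [cite: Drappeau2017, §5.5]
* E. Assing, V. Blomer, J. Li, Adv. Math. 393 (2021), arXiv:2005.13915, Theorem 2.3.
  [cite: AssingBlomerLi2020, Theorem 2.3]
-/

noncomputable section

open scoped ContDiff Topology
open Filter Finset

namespace Literature.NumberTheory.Sieve

namespace KloostermanQuintilinear

/-! ### The concrete one-variable factors -/

/-- `γ(q₀t)` with `γ = BFI.bumpC S Y`. [cite: Drappeau2017, §5.5] -/
def gammaDil (S Y q₀ : ℝ) (t : ℝ) : ℂ := BFI.bumpC S Y (q₀ * t)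

/-- The smooth splitting function `w₁(q₀t)`, `w₁ = BFI.bumpC (7S/10) (S/20)` (`≡ 1` on
`[7S/10, 7S/5]`, `= 0` off `(13S/20, 29S/20)`). [folklore] -/
def splitDil (S q₀ : ℝ) (t : ℝ) : ℂ := BFI.bumpC (7 / 10 * S) (1 / 20 * S) (q₀ * t)

/-- Lower dyadic piece `γ(q₀t) w₁(q₀t)`. [folklore] -/
def pieceLo (S Y q₀ : ℝ) (t : ℝ) : ℂ := gammaDil S Y q₀ t * splitDil S q₀ t

/-- Upper dyadic piece `γ(q₀t) (1 − w₁(q₀t))`. [folklore] -/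
def pieceHi (S Y q₀ : ℝ) (t : ℝ) : ℂ := gammaDil S Y q₀ t - pieceLo S Y q₀ t

/-- The cut-off `BFI.bumpC M (M/2)`: `≡ 1` on `[M, 2M]`, supported in `(M/2, 5M/2)`. [folklore] -/
def plateau (M : ℝ) (t : ℝ) : ℂ := BFI.bumpC M (M / 2) t

/-- The profile `α = BFI.bumpC 1 (1/2)` (`α(m/M)` is the majorant of Drappeau 2017, §5.2 in the
tree's normalisation). [cite: Drappeau2017, §5.2] -/
def alphaProfile (t : ℝ) : ℂ := BFI.bumpC 1 (1 / 2) t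

/-- The five-variable weight `g(c,d,n,r,s) = A(c) B(d) α(κcd) · plateau_{Mn}(n) plateau_R(r) plateau_{S'}(s)`
(`A, B ∈ {pieceLo, pieceHi}`, `κ = q₀ξ/M`). [cite: Drappeau2017, §5.5] -/
def drWeight (A B : ℝ → ℂ) (κ Mn R S' : ℝ) : ℝ → ℝ → ℝ → ℝ → ℝ → ℂ :=
  fun c d n r s => A c * B d * alphaProfile (κ * c * d) * plateau Mn n * plateau R r * plateau S' s

/-- `pieceLo + pieceHi = gammaDil`. [folklore] -/
theorem pieceLo_add_pieceHi (S Y q₀ t : ℝ) : pieceLo S Y q₀ t + pieceHi S Y q₀ t = gammaDil S Y q₀ t := by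
  unfold pieceHi; ring

/-! ### Smoothness -/

/-- [folklore] -/
theorem contDiff_gammaDil (S Y q₀ : ℝ) : ContDiff ℝ ∞ (gammaDil S Y q₀) :=
  (BFI.contDiff_bumpC S Y).comp (contDiff_const.mul contDiff_id)

/-- [folklore] -/
theorem contDiff_splitDil (S q₀ : ℝ) : ContDiff ℝ ∞ (splitDil S q₀) :=
  (BFI.contDiff_bumpC _ _).comp (contDiff_const.mul contDiff_id)

/-- [folklore] -/
theorem contDiff_pieceLo (S Y q₀ : ℝ) : ContDiff ℝ ∞ (pieceLo S Y q₀) :=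
  (contDiff_gammaDil S Y q₀).mul (contDiff_splitDil S q₀)

/-- [folklore] -/
theorem contDiff_pieceHi (S Y q₀ : ℝ) : ContDiff ℝ ∞ (pieceHi S Y q₀) :=
  (contDiff_gammaDil S Y q₀).sub (contDiff_pieceLo S Y q₀)

/-- [folklore] -/
theorem contDiff_plateau (M : ℝ) : ContDiff ℝ ∞ (plateau M) := BFI.contDiff_bumpC _ _

/-- [folklore] -/
theorem contDiff_alphaProfile : ContDiff ℝ ∞ alphaProfile := BFI.contDiff_bumpC _ _

/-! ### Supports -/

/-- `γ(q₀t) ≠ 0 ⟹ S − Y < q₀t < 2S + Y`. [folklore] -/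
theorem gammaDil_ne_zero {S Y q₀ t : ℝ} (hY : 0 < Y) (hS : 0 ≤ S) (h : gammaDil S Y q₀ t ≠ 0) :
    S - Y < q₀ * t ∧ q₀ * t < 2 * S + Y := by
  unfold gammaDil at h
  constructor
  · by_contra h'; exact h (BFI.bumpC_eq_zero hY hS (Or.inl (not_lt.1 h')))
  · by_contra h'; exact h (BFI.bumpC_eq_zero hY hS (Or.inr (not_lt.1 h')))

/-- `w₁(q₀t) ≠ 0 ⟹ 13S/20 < q₀t < 29S/20`. [folklore] -/
theorem splitDil_ne_zero {S q₀ t : ℝ} (hS : 0 < S) (h : splitDil S q₀ t ≠ 0) :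
    13 / 20 * S < q₀ * t ∧ q₀ * t < 29 / 20 * S := by
  unfold splitDil at h
  have hY : (0 : ℝ) < 1 / 20 * S := by positivity
  have hM : (0 : ℝ) ≤ 7 / 10 * S := by positivity
  constructor
  · by_contra h'; exact h (BFI.bumpC_eq_zero hY hM (Or.inl (by linarith [not_lt.1 h'])))
  · by_contra h'; exact h (BFI.bumpC_eq_zero hY hM (Or.inr (by linarith [not_lt.1 h'])))

/-- `w₁(q₀t) = 1` for `7S/10 ≤ q₀t ≤ 7S/5`. [folklore] -/
theorem splitDil_eq_one {S q₀ t : ℝ} (hS : 0 < S) (h₁ : 7 / 10 * S ≤ q₀ * t) (h₂ : q₀ * t ≤ 7 / 5 * S) :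
    splitDil S q₀ t = 1 := by
  unfold splitDil
  rw [BFI.bumpC_apply, BFI.bump_eq_one (by positivity) h₁ (by linarith)]
  simp

/-- **Support of the lower piece**: `pieceLo ≠ 0 ⟹ 29S/(40q₀) < t ≤ 29S/(20q₀)` (`0 < Y ≤ S/4`,
`q₀ > 0`). [folklore] -/
theorem pieceLo_ne_zero {S Y q₀ t : ℝ} (hY : 0 < Y) (hYS : Y ≤ S / 4) (hq₀ : 0 < q₀)
    (h : pieceLo S Y q₀ t ≠ 0) : 29 / 40 * S / q₀ < t ∧ t ≤ 2 * (29 / 40 * S / q₀) := by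
  have hS : 0 < S := by linarith
  unfold pieceLo at h
  obtain ⟨h1, _⟩ := gammaDil_ne_zero hY hS.le (left_ne_zero_of_mul h)
  obtain ⟨_, h4⟩ := splitDil_ne_zero hS (right_ne_zero_of_mul h)
  constructor
  · rw [div_lt_iff₀ hq₀]; nlinarith
  · rw [show 2 * (29 / 40 * S / q₀) = (29 / 20 * S) / q₀ by ring, le_div_iff₀ hq₀]; nlinarith

/-- **Support of the upper piece**: `pieceHi ≠ 0 ⟹ 9S/(8q₀) < t ≤ 9S/(4q₀)`. [folklore] -/
theorem pieceHi_ne_zero {S Y q₀ t : ℝ} (hY : 0 < Y) (hYS : Y ≤ S / 4) (hq₀ : 0 < q₀)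
    (h : pieceHi S Y q₀ t ≠ 0) : 9 / 8 * S / q₀ < t ∧ t ≤ 2 * (9 / 8 * S / q₀) := by
  have hS : 0 < S := by linarith
  have e : pieceHi S Y q₀ t = gammaDil S Y q₀ t * (1 - splitDil S q₀ t) := by
    unfold pieceHi pieceLo; ring
  rw [e] at h
  obtain ⟨h1, h2⟩ := gammaDil_ne_zero hY hS.le (left_ne_zero_of_mul h)
  have hw : splitDil S q₀ t ≠ 1 := fun h1 => (right_ne_zero_of_mul h) (by rw [h1, sub_self])
  have hgt : 7 / 5 * S < q₀ * t := by
    by_contra h'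
    exact hw (splitDil_eq_one hS (by linarith) (not_lt.1 h'))
  constructor
  · rw [div_lt_iff₀ hq₀]; nlinarith
  · rw [show 2 * (9 / 8 * S / q₀) = (9 / 4 * S) / q₀ by ring, le_div_iff₀ hq₀]; nlinarith

/-- **Support of the cut-offs**: `plateau M t ≠ 0 ⟹ M/2 < t < 5M/2` (`M > 0`). [folklore] -/
theorem plateau_ne_zero {M t : ℝ} (hM : 0 < M) (h : plateau M t ≠ 0) : M / 2 < t ∧ t < 5 * M / 2 := by
  unfold plateau at h
  have hY : 0 < M / 2 := by positivity
  constructor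
  · by_contra h'; exact h (BFI.bumpC_eq_zero hY hM.le (Or.inl (by linarith [not_lt.1 h'])))
  · by_contra h'; exact h (BFI.bumpC_eq_zero hY hM.le (Or.inr (by linarith [not_lt.1 h'])))

/-- `α(t) ≠ 0 ⟹ 1/2 < t < 5/2`. [folklore] -/
theorem alphaProfile_ne_zero {t : ℝ} (h : alphaProfile t ≠ 0) : 1 / 2 < t ∧ t < 5 / 2 := by
  unfold alphaProfile at h
  constructor
  · by_contra h'; exact h (BFI.bumpC_eq_zero (by norm_num) zero_le_one (Or.inl (by linarith [not_lt.1 h'])))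
  · by_contra h'; exact h (BFI.bumpC_eq_zero (by norm_num) zero_le_one (Or.inr (by linarith [not_lt.1 h'])))

/-- `α = 0` on `[5/2, ∞)`. [folklore] -/
theorem alphaProfile_eq_zero_of_ge {t : ℝ} (ht : 5 / 2 ≤ t) : alphaProfile t = 0 :=
  bumpC_one_half_eq_zero_of_ge ht

/-! ### Vanishing near points below the supports -/

/-- `γ(q₀·)` vanishes near every `t` with `q₀t < S − Y`. [folklore] -/
theorem gammaDil_eventuallyEq_zero {S Y q₀ t : ℝ} (hY : 0 < Y) (hS : 0 ≤ S) (ht : q₀ * t < S - Y) :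
    gammaDil S Y q₀ =ᶠ[𝓝 t] 0 := by
  have hev : ∀ᶠ t' in 𝓝 t, q₀ * t' < S - Y :=
    ((continuous_const.mul continuous_id).continuousAt (x := t)).eventually (Iio_mem_nhds ht)
  exact hev.mono fun t' ht' => BFI.bumpC_eq_zero hY hS (Or.inl ht'.le)

/-- [folklore] -/
theorem pieceLo_eventuallyEq_zero {S Y q₀ t : ℝ} (hY : 0 < Y) (hS : 0 ≤ S) (ht : q₀ * t < S - Y) :
    pieceLo S Y q₀ =ᶠ[𝓝 t] 0 :=
  (gammaDil_eventuallyEq_zero hY hS ht).mono fun t' ht' => by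
    change gammaDil S Y q₀ t' * splitDil S q₀ t' = 0
    rw [ht', Pi.zero_apply, zero_mul]

/-- [folklore] -/
theorem pieceHi_eventuallyEq_zero {S Y q₀ t : ℝ} (hY : 0 < Y) (hS : 0 ≤ S) (ht : q₀ * t < S - Y) :
    pieceHi S Y q₀ =ᶠ[𝓝 t] 0 :=
  (gammaDil_eventuallyEq_zero hY hS ht).mono fun t' ht' => by
    change gammaDil S Y q₀ t' - gammaDil S Y q₀ t' * splitDil S q₀ t' = 0
    rw [ht', Pi.zero_apply, zero_mul, sub_zero]

/-- `plateau M` vanishes near every `t < M/2`. [folklore] -/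
theorem plateau_eventuallyEq_zero {M t : ℝ} (hM : 0 < M) (ht : t < M / 2) : plateau M =ᶠ[𝓝 t] 0 :=
  bumpC_eventuallyEq_zero_of_lt (by positivity) hM.le (by linarith)

/-! ### Derivative bounds -/

/-- [folklore] -/
theorem derivBound_gammaDil {S Y q₀ : ℝ} (hY : 0 < Y) (hSY : 0 ≤ S - Y) (hq₀ : 0 < q₀) (k : ℕ)
    {t : ℝ} (ht : 0 < t) :
    DerivBound (gammaDil S Y q₀) t k (2 * derivConstSum k) (((2 * S + Y) / Y) / t) :=
  derivBound_bumpC_dilate hY hSY hq₀ k ht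

/-- [folklore] -/
theorem derivBound_splitDil {S q₀ : ℝ} (hS : 0 < S) (hq₀ : 0 < q₀) (k : ℕ) {t : ℝ} (ht : 0 < t) :
    DerivBound (splitDil S q₀) t k (2 * derivConstSum k) (29 / t) := by
  have h := derivBound_bumpC_dilate (S := 7 / 10 * S) (Y := 1 / 20 * S) (by positivity)
    (by nlinarith) hq₀ k ht
  have e : (2 * (7 / 10 * S) + 1 / 20 * S) / (1 / 20 * S) = 29 := by
    field_simp; ring
  rw [e] at h
  exact h

/-- **Lower piece**: `DerivBound pieceLo t k (4 derivConstSum² k) (((2S+Y)/Y + 29)/t)`. [folklore] -/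
theorem derivBound_pieceLo {S Y q₀ : ℝ} (hY : 0 < Y) (hYS : Y ≤ S / 4) (hq₀ : 0 < q₀) (k : ℕ)
    {t : ℝ} (ht : 0 < t) :
    DerivBound (pieceLo S Y q₀) t k (4 * derivConstSum k ^ 2) (((2 * S + Y) / Y + 29) / t) := by
  have hS : 0 < S := by linarith
  have h := DerivBound.mul (contDiff_gammaDil S Y q₀) (contDiff_splitDil S q₀)
    (derivBound_gammaDil hY (by linarith) hq₀ k ht) (derivBound_splitDil hS hq₀ k ht)
    (by linarith [one_le_derivConstSum k]) (by positivity)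
  refine h.mono le_rfl (le_of_eq (by ring)) (le_of_eq (by ring)) ?_ (by positivity)
  have := one_le_derivConstSum k; positivity

/-- **Upper piece**: `DerivBound pieceHi t k (6 derivConstSum² k) (((2S+Y)/Y + 29)/t)`. [folklore] -/
theorem derivBound_pieceHi {S Y q₀ : ℝ} (hY : 0 < Y) (hYS : Y ≤ S / 4) (hq₀ : 0 < q₀) (k : ℕ)
    {t : ℝ} (ht : 0 < t) :
    DerivBound (pieceHi S Y q₀) t k (6 * derivConstSum k ^ 2) (((2 * S + Y) / Y + 29) / t) := by
  have hS : 0 < S := by linarith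
  have hD := one_le_derivConstSum k
  have h1 : DerivBound (gammaDil S Y q₀) t k (2 * derivConstSum k ^ 2) (((2 * S + Y) / Y + 29) / t) := by
    refine (derivBound_gammaDil hY (by linarith) hq₀ k ht).mono le_rfl ?_ ?_ (by positivity)
      (by positivity)
    · nlinarith
    · exact div_le_div_of_nonneg_right (by linarith) ht.le
  have h := DerivBound.sub (contDiff_gammaDil S Y q₀) (contDiff_pieceLo S Y q₀) h1
    (derivBound_pieceLo hY hYS hq₀ k ht)
  refine h.mono le_rfl (le_of_eq (by ring)) le_rfl (by positivity) (by positivity)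

/-- [folklore] -/
theorem derivBound_plateau {M : ℝ} (hM : 0 < M) (k : ℕ) {t : ℝ} (ht : 0 < t) :
    DerivBound (plateau M) t k (2 * derivConstSum k) (5 / t) :=
  derivBound_bumpC_plateau hM k ht

/-! ### The constants `MQ` of the profile `α` -/

/-- A fixed family `alphaMQ k ≥ 0` with `‖(t^m α^{(m)})^{(l)}(t)‖ ≤ alphaMQ k` (`m, l ≤ k`).
[folklore] -/
def alphaMQ : ℕ → ℝ := Classical.choose exists_MQ_bumpC

/-- [folklore] -/
theorem alphaMQ_nonneg (k : ℕ) : 0 ≤ alphaMQ k := (Classical.choose_spec exists_MQ_bumpC).1 k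

/-- [folklore] -/
theorem alphaMQ_spec (k m l : ℕ) (hm : m ≤ k) (hl : l ≤ k) (t : ℝ) :
    ‖iteratedDeriv l (powDeriv alphaProfile m) t‖ ≤ alphaMQ k :=
  (Classical.choose_spec exists_MQ_bumpC).2 k m l hm hl t

/-! ### The hypotheses of Theorem 2.1 for `drWeight` -/

/-- **Smoothness** of the uncurried weight. [folklore] -/
theorem contDiff_drWeight {A B : ℝ → ℂ} (hA : ContDiff ℝ ∞ A) (hB : ContDiff ℝ ∞ B)
    (κ Mn R S' : ℝ) :
    ContDiff ℝ (⊤ : ℕ∞)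
      (fun p : Fin 5 → ℝ => drWeight A B κ Mn R S' (p 0) (p 1) (p 2) (p 3) (p 4)) := by
  unfold drWeight
  have h0 : ContDiff ℝ ∞ (fun p : Fin 5 → ℝ => p 0) := contDiff_apply ℝ ℝ 0
  have h1 : ContDiff ℝ ∞ (fun p : Fin 5 → ℝ => p 1) := contDiff_apply ℝ ℝ 1
  have h2 : ContDiff ℝ ∞ (fun p : Fin 5 → ℝ => p 2) := contDiff_apply ℝ ℝ 2
  have h3 : ContDiff ℝ ∞ (fun p : Fin 5 → ℝ => p 3) := contDiff_apply ℝ ℝ 3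
  have h4 : ContDiff ℝ ∞ (fun p : Fin 5 → ℝ => p 4) := contDiff_apply ℝ ℝ 4
  exact (((((hA.comp h0).mul (hB.comp h1)).mul (contDiff_alphaProfile.comp
    ((contDiff_const.mul h0).mul h1))).mul ((contDiff_plateau Mn).comp h2)).mul
    ((contDiff_plateau R).comp h3)).mul ((contDiff_plateau S').comp h4)

/-- **Support**: `g ≠ 0 ⟹ C < c ≤ 2C, D < d ≤ 2D, n, r, s > 0` when `A, B` are supported in
`(C,2C], (D,2D]` and `Mn, R, S' > 0`. [folklore] -/
theorem drWeight_ne_zero {A B : ℝ → ℂ} {C D : ℝ} (hAs : ∀ t, A t ≠ 0 → C < t ∧ t ≤ 2 * C)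
    (hBs : ∀ t, B t ≠ 0 → D < t ∧ t ≤ 2 * D) (κ : ℝ) {Mn R S' : ℝ} (hMn : 0 < Mn) (hR : 0 < R)
    (hS' : 0 < S') {c d n r s : ℝ} (h : drWeight A B κ Mn R S' c d n r s ≠ 0) :
    C < c ∧ c ≤ 2 * C ∧ D < d ∧ d ≤ 2 * D ∧ 0 < n ∧ 0 < r ∧ 0 < s := by
  unfold drWeight at h
  have hA' := hAs c (left_ne_zero_of_mul (left_ne_zero_of_mul (left_ne_zero_of_mul
    (left_ne_zero_of_mul (left_ne_zero_of_mul h)))))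
  have hB' := hBs d (right_ne_zero_of_mul (left_ne_zero_of_mul (left_ne_zero_of_mul
    (left_ne_zero_of_mul (left_ne_zero_of_mul h)))))
  have hn := plateau_ne_zero hMn (right_ne_zero_of_mul (left_ne_zero_of_mul (left_ne_zero_of_mul h)))
  have hr := plateau_ne_zero hR (right_ne_zero_of_mul (left_ne_zero_of_mul h))
  have hs := plateau_ne_zero hS' (right_ne_zero_of_mul h)
  exact ⟨hA'.1, hA'.2, hB'.1, hB'.2, by linarith [hn.1], by linarith [hr.1], by linarith [hs.1]⟩

/-- **Compact support** of the uncurried weight. [folklore] -/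
theorem hasCompactSupport_drWeight {A B : ℝ → ℂ} {C D : ℝ} (hAs : ∀ t, A t ≠ 0 → C < t ∧ t ≤ 2 * C)
    (hBs : ∀ t, B t ≠ 0 → D < t ∧ t ≤ 2 * D) (κ : ℝ) {Mn R S' : ℝ} (hMn : 0 < Mn) (hR : 0 < R)
    (hS' : 0 < S') :
    HasCompactSupport
      (fun p : Fin 5 → ℝ => drWeight A B κ Mn R S' (p 0) (p 1) (p 2) (p 3) (p 4)) := by
  -- the box `[C,2C] × [D,2D] × [0,5Mn/2] × [0,5R/2] × [0,5S'/2]`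
  let K : Fin 5 → Set ℝ := ![Set.Icc C (2 * C), Set.Icc D (2 * D), Set.Icc 0 (5 * Mn / 2),
    Set.Icc 0 (5 * R / 2), Set.Icc 0 (5 * S' / 2)]
  refine HasCompactSupport.intro (K := Set.pi Set.univ K) (isCompact_univ_pi fun i => ?_) ?_
  · fin_cases i <;> exact isCompact_Icc
  · intro p hp
    by_contra h
    apply hp
    obtain ⟨h1, h2, h3, h4, h5, h6, h7⟩ := drWeight_ne_zero hAs hBs κ hMn hR hS' h
    unfold drWeight at h
    have hn := plateau_ne_zero hMn (right_ne_zero_of_mul (left_ne_zero_of_mul (left_ne_zero_of_mul h)))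
    have hr := plateau_ne_zero hR (right_ne_zero_of_mul (left_ne_zero_of_mul h))
    have hs := plateau_ne_zero hS' (right_ne_zero_of_mul h)
    rw [Set.mem_univ_pi]
    intro i
    fin_cases i
    · exact ⟨h1.le, h2⟩
    · exact ⟨h3.le, h4⟩
    · exact ⟨h5.le, hn.2.le⟩
    · exact ⟨h6.le, hr.2.le⟩
    · exact ⟨h7.le, hs.2.le⟩

/-- **The derivative hypothesis (2.2) of Theorem 2.1 for `drWeight A B κ Mn R S'`.**  Suppose the
smooth `A, B` have pointwise bounds `(XA k, L/t)`, `(XB k, L/t)` at every `t > 0`, vanish near every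
`t` with `q₀t < S − Y` … (abstractly: near every `t < tmin`, `tmin > 0`), and the loss `L` is
absorbed: `L + 3 ≤ Λ t^{ε₀}` for `t ≥ tmin` (`0 ≤ ε₀ ≤ 1`).  Let `κ ≥ 0`, `Mn ≥ 1/2`, `R, S' ≥ 1`.
Then for all `ν` and all `c, d, n, r, s > 0`:
`‖∂^ν g‖ ≤ K_ν (c^{-ν₀}d^{-ν₁}n^{-ν₂}r^{-ν₃}s^{-ν₄})^{1-ε₀}`,
`K_ν = XA(ν₀)XB(ν₁)·alphaMQ(ν₀+ν₁)·8·DCS(ν₂)DCS(ν₃)DCS(ν₄)·Λ^{ν₀}Λ^{ν₁}·20^{ν₂}10^{ν₃}10^{ν₄}`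
(`DCS = derivConstSum`), a family depending on `ν` (and the absolute `Λ`) only.
[cite: Drappeau2017, Theorem 2.1 (2.2), §5.5 p. 20] -/
theorem norm_mixedDeriv_drWeight_le {A B : ℝ → ℂ} (hA : ContDiff ℝ ∞ A) (hB : ContDiff ℝ ∞ B)
    {XA XB : ℕ → ℝ} (hXA : ∀ k, 0 ≤ XA k) (hXB : ∀ k, 0 ≤ XB k) {L : ℝ} (hL : 0 ≤ L)
    (hAb : ∀ (k : ℕ) (t : ℝ), 0 < t → DerivBound A t k (XA k) (L / t))
    (hBb : ∀ (k : ℕ) (t : ℝ), 0 < t → DerivBound B t k (XB k) (L / t))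
    {tmin : ℝ} (hAz : ∀ t : ℝ, 0 < t → t < tmin → A =ᶠ[𝓝 t] 0)
    (hBz : ∀ t : ℝ, 0 < t → t < tmin → B =ᶠ[𝓝 t] 0)
    {ε₀ Λ : ℝ} (hε₀ : 0 ≤ ε₀) (hε₁ : ε₀ ≤ 1) (hΛ : 0 ≤ Λ)
    (hΛt : ∀ t : ℝ, tmin ≤ t → L + 3 ≤ Λ * t ^ ε₀)
    {κ Mn R S' : ℝ} (hκ : 0 ≤ κ) (hMn : 1 / 2 ≤ Mn) (hR : 1 ≤ R) (hS' : 1 ≤ S')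
    (ν : Fin 5 → ℕ) {c d n r s : ℝ} (hc : 0 < c) (hd : 0 < d) (hn : 0 < n) (hr : 0 < r)
    (hs : 0 < s) :
    ‖mixedDeriv ν (drWeight A B κ Mn R S') c d n r s‖ ≤
      (XA (ν 0) * XB (ν 1) * alphaMQ (ν 0 + ν 1) * (2 * derivConstSum (ν 2)) *
          (2 * derivConstSum (ν 3)) * (2 * derivConstSum (ν 4)) *
        (Λ ^ (ν 0) * Λ ^ (ν 1) * (5 / min 1 (1 / 4 : ℝ)) ^ (ν 2) * (5 / min 1 (1 / 2 : ℝ)) ^ (ν 3) *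
          (5 / min 1 (1 / 2 : ℝ)) ^ (ν 4))) *
      (c ^ (-(ν 0 : ℝ)) * d ^ (-(ν 1 : ℝ)) * n ^ (-(ν 2 : ℝ)) * r ^ (-(ν 3 : ℝ)) *
        s ^ (-(ν 4 : ℝ))) ^ (1 - ε₀) := by
  have hMn0 : 0 < Mn := by linarith
  have hR0 : 0 < R := by linarith
  have hS0 : 0 < S' := by linarith
  have h := norm_mixedDeriv_le_rpow (A := A) (B := B) (P := alphaProfile) (U := plateau Mn)
    (V := plateau R) (W := plateau S') hA hB contDiff_alphaProfile (T₀ := 5 / 2) (T := 3)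
    (by norm_num) (by norm_num) (fun t ht => alphaProfile_eq_zero_of_ge ht) alphaMQ_nonneg
    (fun k m l hm hl t => alphaMQ_spec k m l hm hl t) hXA hXB
    (XU := fun k => 2 * derivConstSum k) (XV := fun k => 2 * derivConstSum k)
    (XW := fun k => 2 * derivConstSum k)
    (fun k => by linarith [one_le_derivConstSum k]) (fun k => by linarith [one_le_derivConstSum k])
    (fun k => by linarith [one_le_derivConstSum k]) hL hL (LU := 5) (LV := 5) (LW := 5)
    (by norm_num) (by norm_num) (by norm_num) hAb hBb
    (fun k t ht => derivBound_plateau hMn0 k ht) (fun k t ht => derivBound_plateau hR0 k ht)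
    (fun k t ht => derivBound_plateau hS0 k ht) hκ hε₀ hε₁ hΛ
    (nmin := 1 / 4) (rmin := 1 / 2) (smin := 1 / 2) (by norm_num) (by norm_num) (by norm_num)
    hAz hBz
    (fun t _ ht => plateau_eventuallyEq_zero hMn0 (by linarith))
    (fun t _ ht => plateau_eventuallyEq_zero hR0 (by linarith))
    (fun t _ ht => plateau_eventuallyEq_zero hS0 (by linarith))
    (by intro t ht; have := hΛt t ht; linarith) (by intro t ht; have := hΛt t ht; linarith)
    ν hc hd hn hr hs
  unfold drWeight
  exact h

end KloostermanQuintilinear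

end Literature.NumberTheory.Sieve

end
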